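import Summits.Ventures.HSemireg.WedgeHankelRecurrenceGaussKernelTrace

/-!
# Venture HSemireg — **CLENSHAW'S ALGORITHM FOR A MONIC THREE-TERM RECURRENCE**: the finite expansion `S(x) = Σ_{k≤n} c_k q_k(x)` is the value `y_0` of the BACKWARD recurrence
# `y_{n+1} = y_{n+2} = 0`, `y_k = c_k + (x − a_k) y_{k+1} − b_{k+1} y_{k+2}` (`k = n, n−1, …, 0`) — no `q_k` is ever formed; with the loop invariant
# `S = Σ_{k≤i} c_k q_k + y_{i+1} q_{i+1} − b_{i+1} y_{i+2} q_i`

HONEST FRAMING. Part of the Lean index of the computation cell `pub-hsemireg` (seat p10 gen 44, Sunday typer «UNIFORM-IN-n»).  Real polynomials and finite sums only; no variety, no cohomology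
theory, no sheaf, no Ext group and no semiregularity map is constructed here; nothing here says that HC / HC_CM / HC_AV holds; no Literature fact (unproved `Prop`) is declared or used.  Custodian
versions as in `WedgeHankelSiegelIdeal` (1/3).
SOURCES (cited).  C. W. Clenshaw, *A note on the summation of Chebyshev series*, Math. Tables Aids Comput. 9 (1955) 118–120; W. H. Press et al., *Numerical Recipes* (3rd ed.) §5.4.2 (Clenshaw's
recurrence formula for `Σ c_k F_k` with `F_{k+1} = α_k F_k + β_k F_{k−1}`); W. Gautschi, *Orthogonal Polynomials: Computation and Approximation* (2004) §2.1 (Algorithm 2.2).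
PROOF TYPED HERE.  Descending induction on the loop invariant, using `q_{i+2} = (x − a_{i+1}) q_{i+1} − b_{i+1} q_i`; at `i = 0` the invariant reads `c_0 + (x − a_0) y_1 − b_1 y_2 = y_0`.
DEDUP DISCLOSURE (`rg -n -i 'clenshaw|backward recurrence' Summits Literature`, 2026-09-03): nothing in the tree.  The 3 names below: 0 hits tree-wide.

WHAT IS IN THE TREE.  The recurrence hypotheses only (N279 conventions).
THIS FILE (namespace `Summit.Ventures.HSemireg.Wedge.HankelOuter` continued; CHAINED on N326 (import only); 0 definitions):
* §1092 `clenshaw_invariant` (the loop invariant for every `i ≤ n`), **`clenshaw_eval`** (`Σ_{k≤n} c_k q_k(x) = y_0`), `clenshaw_eval_basis` (`q_n(x)` itself: `c = δ_n`).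
CAVEATS.  The backward sequence `y` is taken by value (any `y : ℕ → ℝ` satisfying the recurrence on `k ≤ n` with `y_{n+1} = y_{n+2} = 0`).  Nothing Ext-side.  New names only.
-/

open Module Polynomial
open scoped Matrix Polynomial

namespace Summit.Ventures.HSemireg.Wedge.HankelOuter

/-! ## §1092. Clenshaw's algorithm -/

/-- **The loop invariant**: for every `i ≤ n`, `Σ_{k≤n} c_k q_k(x) = Σ_{k≤i} c_k q_k(x) + y_{i+1} q_{i+1}(x) − b_{i+1} y_{i+2} q_i(x)`. [Clenshaw 1955; this file, §1092] -/
theorem clenshaw_invariant {q : ℕ → ℝ[X]} {a b : ℕ → ℝ}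
    (hrec : ∀ n, q (n + 2) = (Polynomial.X - C (a (n + 1))) * q (n + 1) - C (b (n + 1)) * q n) (c : ℕ → ℝ) (n : ℕ) (x : ℝ) {y : ℕ → ℝ}
    (hyn1 : y (n + 1) = 0) (hyn2 : y (n + 2) = 0) (hy : ∀ k, k ≤ n → y k = c k + (x - a k) * y (k + 1) - b (k + 1) * y (k + 2)) {i : ℕ} (hi : i ≤ n) :
    (∑ k ∈ Finset.range (n + 1), C (c k) * q k).eval x = (∑ k ∈ Finset.range (i + 1), C (c k) * q k).eval x + y (i + 1) * (q (i + 1)).eval x - b (i + 1) * y (i + 2) * (q i).eval x := by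
  -- descending induction on `i`, written as induction on `d = n − i`
  suffices h : ∀ d i, i + d = n → (∑ k ∈ Finset.range (n + 1), C (c k) * q k).eval x =
      (∑ k ∈ Finset.range (i + 1), C (c k) * q k).eval x + y (i + 1) * (q (i + 1)).eval x - b (i + 1) * y (i + 2) * (q i).eval x from h (n - i) i (by omega)
  intro d
  induction d with
  | zero =>
    intro i hi
    rw [Nat.add_zero] at hi
    subst hi
    rw [hyn1, hyn2, zero_mul, mul_zero, zero_mul, add_zero, sub_zero]
  | succ d ih =>
    intro i hi
    have h := ih (i + 1) (by omega)
    rw [h, Finset.sum_range_succ _ (i + 1), eval_add, eval_mul, eval_C, hrec i, eval_sub, eval_mul, eval_mul, eval_sub, eval_X, eval_C, eval_C, hy (i + 1) (by omega)]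
    ring

/-- **CLENSHAW'S ALGORITHM: `Σ_{k≤n} c_k q_k(x) = y_0`** for the backward recurrence `y_{n+1} = y_{n+2} = 0`, `y_k = c_k + (x − a_k) y_{k+1} − b_{k+1} y_{k+2}` (`k ≤ n`).
[Clenshaw 1955; Numerical Recipes §5.4.2; Gautschi 2004 Alg. 2.2; this file, §1092] -/
theorem clenshaw_eval {q : ℕ → ℝ[X]} {a b : ℕ → ℝ} (hq0 : q 0 = 1) (hq1 : q 1 = Polynomial.X - C (a 0))
    (hrec : ∀ n, q (n + 2) = (Polynomial.X - C (a (n + 1))) * q (n + 1) - C (b (n + 1)) * q n) (c : ℕ → ℝ) (n : ℕ) (x : ℝ) {y : ℕ → ℝ}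
    (hyn1 : y (n + 1) = 0) (hyn2 : y (n + 2) = 0) (hy : ∀ k, k ≤ n → y k = c k + (x - a k) * y (k + 1) - b (k + 1) * y (k + 2)) :
    (∑ k ∈ Finset.range (n + 1), C (c k) * q k).eval x = y 0 := by
  rw [clenshaw_invariant hrec c n x hyn1 hyn2 hy (Nat.zero_le n), Nat.zero_add, Finset.sum_range_one, eval_mul, eval_C, hq0, hq1, eval_one, eval_sub, eval_X, eval_C,
    hy 0 (Nat.zero_le n)]
  ring

/-- **`q_n(x)` itself by Clenshaw** (`c_k = [k = n]`): `q_n(x) = y_0` for `y_{n+1} = y_{n+2} = 0`, `y_n = 1 + (x − a_n)·0 − b_{n+1}·0`, `y_k = (x − a_k) y_{k+1} − b_{k+1} y_{k+2}` (`k < n`).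
[this file, §1092] -/
theorem clenshaw_eval_basis {q : ℕ → ℝ[X]} {a b : ℕ → ℝ} (hq0 : q 0 = 1) (hq1 : q 1 = Polynomial.X - C (a 0))
    (hrec : ∀ n, q (n + 2) = (Polynomial.X - C (a (n + 1))) * q (n + 1) - C (b (n + 1)) * q n) (n : ℕ) (x : ℝ) {y : ℕ → ℝ}
    (hyn1 : y (n + 1) = 0) (hyn2 : y (n + 2) = 0) (hy : ∀ k, k ≤ n → y k = (if k = n then 1 else 0) + (x - a k) * y (k + 1) - b (k + 1) * y (k + 2)) :
    (q n).eval x = y 0 := by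
  rw [← clenshaw_eval hq0 hq1 hrec (fun k => if k = n then (1 : ℝ) else 0) n x hyn1 hyn2 hy, eval_finsetSum]
  rw [Finset.sum_eq_single n (fun k _ hk => by rw [if_neg hk, C_0, zero_mul, eval_zero]) (fun h => absurd (Finset.self_mem_range_succ n) h), if_pos rfl, C_1, one_mul]

end Summit.Ventures.HSemireg.Wedge.HankelOuter
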